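import Mathlib
import HarnessLib

/-!
# Bordered adjugate: the adjugate block of a Schur-complemented matrix

For a block matrix `M = fromBlocks A B C D` over a commutative ring with `D` invertible and Schur
complement `S = A - B ⅟D C`, Mathlib has `det M = det D · det S` (`Matrix.det_fromBlocks₂₂`).
Here: the upper-left block of the ADJUGATE, entrywise,
`adj M (inl i) (inl k) = det D · adj S i k` (`adjugate_fromBlocks_inl_inl`) — with no
invertibility assumption on `S` (both sides are cofactors; the proof is `adjugate_apply` +
`det_fromBlocks₂₂` on the row-updated block matrix).  This is the "bordering" / port-compression
identity: multiplying a matrix pencil by a fixed invertible exterior block rescales determinant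
and adjugate block by the same factor `det D`, so cofactor/determinant comparisons live on the
Schur complement.
-/

namespace Literature.LinearAlgebra.Matrix

open _root_.Matrix

variable {m n α : Type*} [Fintype m] [Fintype n] [DecidableEq m] [DecidableEq n] [CommRing α]

omit [Fintype m] [Fintype n] [CommRing α] in
/-- Updating an upper row of a block matrix updates the two upper blocks. [folklore] -/
theorem fromBlocks_updateRow_inl (A : Matrix m m α) (B : Matrix m n α) (C : Matrix n m α)
    (D : Matrix n n α) (k : m) (v : m ⊕ n → α) :
    (fromBlocks A B C D).updateRow (Sum.inl k) v =
      fromBlocks (A.updateRow k (v ∘ Sum.inl)) (B.updateRow k (v ∘ Sum.inr)) C D := by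
  ext (i | i) (j | j)
  · by_cases h : i = k
    · subst h; simp [updateRow_apply]
    · simp [updateRow_apply, h]
  · by_cases h : i = k
    · subst h; simp [updateRow_apply]
    · simp [updateRow_apply, h]
  · simp [updateRow_apply]
  · simp [updateRow_apply]

/-- **Bordered adjugate**: for `D` invertible, the upper-left block of `adj (fromBlocks A B C D)`
is `det D` times the adjugate of the Schur complement `A - B ⅟D C`, entrywise, with no
assumption on the Schur complement. [folklore] -/
theorem adjugate_fromBlocks_inl_inl (A : Matrix m m α) (B : Matrix m n α) (C : Matrix n m α)
    (D : Matrix n n α) [Invertible D] (i k : m) :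
    (fromBlocks A B C D).adjugate (Sum.inl i) (Sum.inl k) =
      D.det * (A - B * ⅟D * C).adjugate i k := by
  rw [adjugate_apply, fromBlocks_updateRow_inl, det_fromBlocks₂₂, adjugate_apply]
  congr 2
  ext r s
  by_cases h : r = k
  · subst h
    simp [updateRow_apply, Matrix.sub_apply, Matrix.mul_apply, Pi.single_apply]
  · simp only [Matrix.sub_apply, updateRow_apply, if_neg h, Matrix.mul_apply]

end Literature.LinearAlgebra.Matrix
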